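import Mathlib
import HarnessLib

/-!
# Eigenspaces commute with flat base change: `dim_ℂ H_ℂ(q) = dim_ℚ H_ℚ(q)` for a rational eigenvalue

Family `hodge`, layer `Literature/AlgebraicGeometry/HodgeTheory`. THEOREMS only, for crux K1 of
`Summits/HodgeConjecture/HodgeConjecture/Theses/CyclicUnitaryPowers.lean` (lane D glue, hole S2: the invariant
line `dim H_ℚ(1) ≤ 1` of statement D controls `dim_ℂ H(1) = dim_ℂ H(ζ^0)`).  The eigenspace of `τ ⊗ ℂ` at a
RATIONAL eigenvalue `q` is the base change of the eigenspace of `τ` at `q` (kernels commute with the flat base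
change `ℚ → ℂ`, Mathlib's `LinearMap.tensorKerEquiv`), so the dimensions agree.
Written by the prover seat `hodge-nonav-prover-Ax`.

## References
* [Borel1991] A. Borel, *Linear Algebraic Groups*, AG §14.2 (base change of kernels for field extensions).
* [CarlsonToledo1999] J. A. Carlson, D. Toledo, Duke Math. J. 97 (1999), §6 (the invariant part `H(1)`).
-/

noncomputable section

open Module
open scoped TensorProduct

namespace Literature.AlgebraicGeometry.HodgeTheory

universe v

variable {V : Type v} [AddCommGroup V] [Module ℚ V]

/-- The eigenspace of `τ ⊗ ℂ` at a rational eigenvalue is the kernel of the base change of `τ − q`.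
[cite: Borel1991, AG §14.2] -/
theorem eigenspace_baseChange_eq_ker (τ : V →ₗ[ℚ] V) (q : ℚ) :
    Module.End.eigenspace (τ.baseChange ℂ) (q : ℂ) = LinearMap.ker ((τ - q • LinearMap.id).baseChange ℂ) := by
  ext x
  rw [Module.End.mem_eigenspace_iff, LinearMap.mem_ker, LinearMap.baseChange_sub, LinearMap.sub_apply,
    sub_eq_zero, LinearMap.baseChange_smul, LinearMap.smul_apply, LinearMap.baseChange_id, LinearMap.id_apply,
    ← algebraMap_smul ℂ q x]
  rfl

/-- **`dim_ℂ H_ℂ(q) = dim_ℚ H_ℚ(q)`** for a rational eigenvalue `q` of a rational endomorphism `τ` (flat base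
change of kernels). [cite: Borel1991, AG §14.2] -/
theorem finrank_eigenspace_baseChange [Module.Finite ℚ V] (τ : V →ₗ[ℚ] V) (q : ℚ) :
    finrank ℂ (Module.End.eigenspace (τ.baseChange ℂ) (q : ℂ)) = finrank ℚ (Module.End.eigenspace τ q) := by
  rw [eigenspace_baseChange_eq_ker]
  have hker : Module.End.eigenspace τ q = LinearMap.ker (τ - q • LinearMap.id) := by
    ext x
    rw [Module.End.mem_eigenspace_iff, LinearMap.mem_ker, LinearMap.sub_apply, sub_eq_zero, LinearMap.smul_apply,
      LinearMap.id_apply]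
  rw [hker]
  have e := LinearMap.tensorKerEquiv ℂ ℂ (τ - q • LinearMap.id)
  rw [← Module.finrank_baseChange (R := ℂ) (S := ℚ) (M' := LinearMap.ker (τ - q • LinearMap.id))]
  exact (LinearEquiv.finrank_eq e).symm

end Literature.AlgebraicGeometry.HodgeTheory

end
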